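import Summits.Parity.GeneralizedHardyLittlewood.Theorems.PrimeLevelFamEdgeIdeaDeltasPeterssonLayersBands
import HarnessLib

/-!
# D-0145 LINE «petersson_layers» v4 — SAME seven stubs and composition as v3, now stated AGAINST THE LANDED DECKS
# (lead prover-lead-stmt-Parity-20007 g2, 2026-08-28; reshape of record, mathematics unchanged)

v3 (`Lines/petersson_layers.lean` sha16 9cdeac996210, seat ls-idea-lens-17 gen 3; registered under the lead 2026-08-28T10:10Z and
re-registered 11:24Z) carried its OWN copies of §1–§6 (AFE weights, spectral sum, diagonal / layers / heart / tail, the piece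
statements `HasShape`/`SubOf`/…, the glue and the cuts `rhoCore`/`rhoP`) in the namespace
`…Cruxes.MomentsBeyondDiagonal.PeterssonLayers`. Those §1–§6 are LANDED, byte-identical up to the namespace, as the three
Theorems decks 21a–c (`…Theorems.PrimeLevelFamEdgeIdeaDeltasPeterssonLayers{Split,Heart,Bands}`, typer ls-idea-typ-1 gen 3), and
every kernel artefact on this crux since (lead g0: p624563 `…MomentsBeyondDiagonalQuantifiers`, p624994 `…RefutationShapes`,
p625494 `…CoreIsCrux`; crux-plan companions `Lines/*_redundancy.lean`) is stated against the DECK constants. A stub proved in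
`Theorems/` can only be stated against the deck constants too (Theorems files cannot import `Cruxes/`). v4 therefore DROPS the
private copies and `open`s the deck namespace: the seven registered stub NAMES and SIGNATURES are textually unchanged
(`stub_first : SubFirst`, `stub_diag : SubDiag`, `stub_rung : SubRung`, `stub_core : SubUpper rhoCore`,
`stub_band : SubBand rhoCore rhoP`, `stub_identP : TailNearFar rhoP`, `stub_farP : SubFar rhoP`), they now denote the deck
constants, and a landed `Theorems/…` theorem with that signature closes the corresponding `sorry` by `exact`. The composition
`MomentsBeyondDiagonal_of` is the deck's `MomentsBeyondDiagonal_of_sevenSplitBands` (kernel-checked there) and concludes the crux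
`PrimeLevelFamEdge.MomentsBeyondDiagonal` BY NAME. For the mathematics of the seam, the cut, the count and the three-band heart see
the deck docstrings (21a §1–§4, 21b §5/§5b, 21c §5c/§6) — not repeated here.

STATUS LEDGER (lead g2, 2026-08-28; kernel facts cited by proposal id):
* modulo the other six stubs EACH of `stub_core`, `stub_rung`, `stub_band`, `stub_diag`, `stub_farP` is ⟺ K_A (p625494): the
  line is K_A re-cut, not weakened; the ∀-in-q burden («∃ C q₀ ∀ prime q ≥ q₀») sits in EVERY `SubOf` piece and the level-free
  functional of a piece is its unique limit (p624563); refutation shapes p624994.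
* `stub_core` (held by the lead) = the crux proper: open in print (registry famE-02); ¬(A)-strength by the route's barrier notes
  (BN-7a/BN-18); both round-1 crux-plans (`exceptional-free-level-dichotomy`, `bprz-gl1-twin-transfer`) ended `no-skeleton` with
  kernel redundancy certificates (an (A)-excluding atom alone already gives `c/log D ≤ |L(1,χ)|`); round-2 crux ideation BLOCKED
  (evidence #54). Nothing here proves or claims GRH, a zero-free region, or anything about Landau–Siegel zeros.
* satellites: `stub_first` at `Q = 1` is the tree's `KMV2000.firstDisplay_of_bettin'` with `bettin2017_theorem11_primeLevel_holds`
  (unconditional); the ∀Q versions of `stub_first` / `stub_identP` wait on the all-orders AFE (`kmv2000_eq22`, only `k = 0` proved: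
  `kmv2000_eq22_zero_holds`); `stub_diag` = KMV residues (23)–(28) with the pair constraint; `stub_farP` = Pascadi 2025 Thm 7.1
  (not typed) ∪ Weil.
-/

noncomputable section

open scoped MatrixGroups Real
open CongruenceSubgroup Complex Finset Polynomial MeasureTheory
open Literature.NumberTheory.EllipticCurves.ModularForms
open Literature.NumberTheory.LFunctions

namespace Summit.Parity.GeneralizedHardyLittlewood.Cruxes.MomentsBeyondDiagonal.PeterssonLayers

open Summit.Parity.GeneralizedHardyLittlewood.Theses.PrimeLevelFamEdge
open Summit.Parity.GeneralizedHardyLittlewood.Theorems.PrimeLevelFamEdgeIdeaDeltas.PairsSplit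
  (FirstMomentBeyond SubFirst subFirst_of_momentsBeyondDiagonal)
open Summit.Parity.GeneralizedHardyLittlewood.Theorems.PrimeLevelFamEdgeIdeaDeltas.PeterssonLayers

/-! ## §7. D-0145 LINE «petersson_layers» v4: the SEVEN registered stubs (deck constants) and the composition -/

/-- STUB 1 (M; shared with birth / pairs_beyond_family_size): the first display beyond the diagonal (∀ admissible P, ∀ Q even
or odd, some window). At `Q = 1` it is the tree's `KMV2000.firstDisplay_of_bettin'` ∘ `bettin2017_theorem11_primeLevel_holds`;
the general-`Q` case waits on the first-moment AFE with derivatives. -/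
theorem stub_first : SubFirst := by
  sorry

/-- STUB 2 (M/L): the diagonal part `D` has the printed shape (KMV residues (23)–(28) with the pair constraint
`m₁m₂ ≲ q̂²` active; MEANINGFUL via the identification, STATED without it). -/
theorem stub_diag : SubDiag := by
  sorry

/-- STUB 3 (XL; the RUNG of BN-7a (T4)): the single Petersson layer of modulus `q` has the printed shape —
square-root-beating cancellation in the μP-weighted bilinear Kloosterman–Bessel form at ONE prime modulus, for pairs
up to `q̂^{2Δ'}`; by `S(a,b;q) = S(ab,1;q)` it is a function of the product `m₁m₂n₁n₂` and its GL(1) twin is the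
root-number-twisted NON-Hermitian moment `(1/φ(q)) Σ_ψ ε_ψ² L(½,ψ̄)² A(ψ̄)²` (crux dir `Lines/bprz_gl1_twin_transfer_dead.md` §2);
no engine in print. -/
theorem stub_rung : SubRung := by
  sorry

/-- STUB 4 (XL⁺; the CORE = THE CRUX PROPER, held by the lead — every modulus `rq`, `2 ≤ r ≤ q̂^{3(Δ'−1)+1/10}`;
structure-mandatory by the (T1′) operator-norm floor; contains BN-18's residence `r ∈ Dℕ`, `D ≤ q̂^{ρ_c}` (the route's declared
¬(A)-strength content): the core layers have the printed shape with a LEVEL-FREE main term. Modulo the other six stubs this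
statement is ⟺ K_A (p625494 `subUpper_rhoCore_iff_momentsBeyondDiagonal`). -/
theorem stub_core : SubUpper rhoCore := by
  sorry

/-- STUB 5 (L⁺, GENERIC — the BAND `q̂^{3(Δ'−1)+1/10} < r ≤ q̂^{ρ_P}`, character-blind, conjecture-grade, UNPRINTED
(lens-6 t3′)): the band layers have the printed shape (expected `t = 0`). -/
theorem stub_band : SubBand rhoCore rhoP := by
  sorry

/-- STUB 6 (L, TYPING — the identification at the print cut; interchangeable with the Weil cut by
`tailNearFar_rhoP_of_rhoWeil`): `TAIL(ρ_P) = −FAR(ρ_P) + O(q̂ log⁻³ q̂)` — AFE (21)–(22) ∘ Hecke (10) ∘ Petersson (11)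
(+ Weil/KM for `r > q⁸`, `n > q²`). At `Q = 1` every input is a theorem of the tree (`kmv2000_eq22_zero_holds`,
`kmv2000_lemma31_holds`, `kowalskiMichel2000_peterssonFormula_holds`, `kmv2000_p4_real_holds`, `kowalskiMichel2000_peterssonBound`);
the general-`Q` case waits on `kmv2000_eq22` at all orders. -/
theorem stub_identP : TailNearFar rhoP := by
  sorry

/-- STUB 7 (M⁺, PRINT + pencil — the far layers from the print cut: `q̂^{ρ_P} < r ≤ q⁸` have the printed shape with
`t = 0`): Pascadi, arXiv:2511.08445, Thm 7.1 on `(q̂^{ρ_P}, q̂^{ρ_W}]` (not yet a Literature fact), Weil termwise beyond `ρ_W`. -/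
theorem stub_farP : SubFar rhoP := by
  sorry

/-- **THE LINE'S COMPOSITION (v4 = v3, kernel-checked in deck 21c, no sorry of its own): the seven stubs give the crux BY NAME.** -/
theorem MomentsBeyondDiagonal_of : MomentsBeyondDiagonal :=
  MomentsBeyondDiagonal_of_sevenSplitBands stub_first stub_diag stub_rung stub_core stub_band stub_identP stub_farP

/-- v2's composition shape at the Weil cut, from the v4 stubs where they coincide (checked alternative). -/
example (hU : SubUpper rhoWeil) (hF : SubFar rhoWeil) : MomentsBeyondDiagonal :=
  MomentsBeyondDiagonal_of_sixSplitWeil stub_first stub_diag stub_rung hU (tailNearFar_rhoWeil_of_rhoP stub_identP) hF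

end Summit.Parity.GeneralizedHardyLittlewood.Cruxes.MomentsBeyondDiagonal.PeterssonLayers

end
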